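import Summits.ValiantsHypothesis.ValiantsHypothesis.Theorems.KPlusLogSqLawTropicalBMarkers

/-!
# Route `KPlusLogSqLaw`, crux `TropicalB` — linear Toeplitz instances with affine-wrap data: unique optima are rotations

HONEST FRAMING.  Helper toward the registered stubs `stub_tropThin` / `stub_tropFat` of
`Cruxes/TropicalB/Lines/birth.lean` (crux `Summit.ValiantsHypothesis.ValiantsHypothesis.Theses.KPlusLogSqLaw.TropicalB`,
ledger item `stmt-ValiantsHypothesis-19771`, route `KPlusLogSqLaw`; cell `pub-symmetroid`, seat `val-sym-trop-p3`,
2026-08-26).  A structural lemma for the cell's Conjecture T (the LINEAR Toeplitz parametric assignment bound `Φ` that is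
the hypothesis of `toeplitz_chain_le_of_linearBound`, `…TropicalBToeplitzReduction`): it settles the «m-phase» sub-case.
Nothing here bounds `TropicalB` for general designs, and nothing bears on `KPlusLogSqLaw`, `MatrixDescartes` or `VP ≠ VNP`.

THE OBJECT.  A linear Toeplitz instance of size `n + 1` is a pair of integer functions `ψ` (slopes) and `α` (intercepts)
of the integer displacement `δ = a − b ∈ (−(n+1), n+1)` of an entry `(a, b)`; a permutation `σ` has weight
`W_θ(σ) = Σ_b (θ·ψ(σ b − b) + α(σ b − b))` at the integer slope `θ`, and a set `P` of admissible displacements restricts the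
competitors (exactly the shape of the hypothesis of `toeplitz_chain_le_of_linearBound`).

THE HYPOTHESIS (affine-wrap = residue-affine data).  `ψ` and `α` are RESIDUE-AFFINE: for some `M ≠ 0` (one may take
`M = n + 1`), residue tables `Ψ, A : Fin (n+1) → ℤ` and constants `c, c'`,
`M·ψ(a − b) = Ψ(a − b mod (n+1)) + c·(a − b)` and `M·α(a − b) = A(a − b mod (n+1)) + c'·(a − b)` for all entries.
Since `[δ < 0] = ((δ mod m) − δ)/m` on `(−m, m)`, this is the same as «`ψ`, `α` depend on `δ` only through `δ mod m` and an
additive multiple of the WRAP INDICATOR `[δ < 0]`» (`toeplitz_wrapAffine_opt_eq_rotation`), the backbone class of the cell's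
SHIFT-THREE register; the exponent-level wrap term is what the design-level lemma `wrapAffine_chain_succ_le`
(`…TropicalBWrapGauge`, wrap term on the valuations only, class-independent) cannot express.

THE RESULTS.
* `mul_weight_eq_sum_residue` — for residue-affine data, `M·W_θ(σ) = Σ_b G_θ(σ b − b mod (n+1))` with
  `G_θ = θ·Ψ + A`: the linear parts die because the displacements of a permutation sum to `0`
  (`sum_displacement_eq_zero`); what is left is SEPARABLE in the cyclic displacements.
* `toeplitz_affineWrap_opt_eq_rotation` — if moreover every rotation is admissible and `0 < M`, a permutation that is the
  UNIQUE maximiser of `W_θ` among admissible permutations is a ROTATION `b ↦ b + s` (the rotation by an `argmax` of `G_θ`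
  attains the termwise bound `(n+1)·max G_θ ≥ M·W_θ(τ)`, so uniqueness forces equality of permutations).
* `toeplitz_affineWrap_chain_succ_le` — hence any family of PAIRWISE DISTINCT unique maximisers (at arbitrary slopes — no
  monotonicity of the slopes is needed) has at most `n + 1` members: `N + 1 ≤ n + 1`, the «m-phase» bound of Conjecture T.
* `toeplitz_wrapAffine_opt_eq_rotation`, `toeplitz_wrapAffine_chain_succ_le` — the same with the hypothesis written with
  the wrap indicator, `ψ(a − b) = ψ₀(a − b mod (n+1)) + D·[a < b]`, `α(a − b) = α₀(a − b mod (n+1)) + E·[a < b]`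
  (via `val_sub_add_val_eq`, `…TropicalBMarkers`).

References: folklore (separable objective, termwise bound attained by a feasible point); `val_sub_add_val_eq`
(`…TropicalBMarkers`, p422583); the reduction `toeplitz_chain_le_of_linearBound` (`…TropicalBToeplitzReduction`, p429098)
whose hypothesis shape is used verbatim; located note `HOME/val-sym-trop-p3/CONJT-NOTE.md` item 3.
-/

set_option linter.dupNamespace false
set_option autoImplicit false

namespace Summit.ValiantsHypothesis.ValiantsHypothesis.Theorems.KPlusLogSqLaw

open scoped BigOperators
open Finset

section AffineWrap

variable {n : ℕ}

/-- The integer displacements `σ b − b` of a permutation of `Fin n` sum to zero. [folklore] -/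
theorem sum_displacement_eq_zero (σ : Equiv.Perm (Fin n)) : ∑ b, ((σ b : ℤ) - (b : ℤ)) = 0 := by
  rw [sum_sub_distrib, Equiv.sum_comp σ (fun a : Fin n => (a : ℤ))]
  exact sub_self _

/-- The cyclic displacement of the rotation `b ↦ b + s` is the constant `s`. [folklore] -/
theorem addRight_sub_self (s b : Fin (n + 1)) : (Equiv.addRight s b : Fin (n + 1)) - b = s := by
  rw [Equiv.coe_addRight, add_sub_cancel_left]

/-- **Separability of residue-affine instances.**  If `M·ψ(a − b) = Ψ(a − b mod (n+1)) + c·(a − b)` and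
`M·α(a − b) = A(a − b mod (n+1)) + c'·(a − b)` on all entries, then for every permutation `σ` and slope `θ`,
`M · Σ_b (θ ψ(σ b − b) + α(σ b − b)) = Σ_b (θ Ψ(σ b − b) + A(σ b − b))` (cyclic differences on the right): the linear
parts cancel because the displacements sum to zero. [folklore] -/
theorem mul_weight_eq_sum_residue (ψ α : ℤ → ℤ) (Ψ A : Fin (n + 1) → ℤ) (c c' M θ : ℤ)
    (hψ : ∀ a b : Fin (n + 1), M * ψ ((a : ℤ) - b) = Ψ (a - b) + c * ((a : ℤ) - b))
    (hα : ∀ a b : Fin (n + 1), M * α ((a : ℤ) - b) = A (a - b) + c' * ((a : ℤ) - b))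
    (σ : Equiv.Perm (Fin (n + 1))) :
    M * ∑ b, (θ * ψ ((σ b : ℤ) - b) + α ((σ b : ℤ) - b)) = ∑ b, (θ * Ψ (σ b - b) + A (σ b - b)) := by
  have h0 := sum_displacement_eq_zero σ
  calc M * ∑ b, (θ * ψ ((σ b : ℤ) - b) + α ((σ b : ℤ) - b))
      = ∑ b, (θ * (M * ψ ((σ b : ℤ) - b)) + M * α ((σ b : ℤ) - b)) := by
        rw [mul_sum]
        exact sum_congr rfl fun b _ => by ring
    _ = ∑ b, ((θ * Ψ (σ b - b) + A (σ b - b)) + (θ * c + c') * ((σ b : ℤ) - b)) := by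
        refine sum_congr rfl fun b _ => ?_
        rw [hψ, hα]
        ring
    _ = ∑ b, (θ * Ψ (σ b - b) + A (σ b - b)) + (θ * c + c') * ∑ b, ((σ b : ℤ) - b) := by
        rw [sum_add_distrib, mul_sum]
    _ = ∑ b, (θ * Ψ (σ b - b) + A (σ b - b)) := by rw [h0, mul_zero, add_zero]

/-- **Affine-wrap linear Toeplitz instances: a unique optimum is a rotation.**  Let `ψ`, `α` be residue-affine with a
positive multiplier `M` (hypotheses `hψ`, `hα`), let every rotation `b ↦ b + s` of `Fin (n+1)` have admissible
displacements (`hP`), and let `τ` be the UNIQUE maximiser at the slope `θ` of `Σ_b (θ ψ(σ b − b) + α(σ b − b))` among the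
permutations `σ` with admissible displacements.  Then `τ` is a rotation.  (The rotation by an `argmax s` of
`G = θ·Ψ + A` has `M`-fold weight `(n+1)·G s ≥ Σ_b G(τ b − b) = M·W(τ)`; were it different from `τ`, uniqueness would give
the reverse strict inequality.) [folklore] -/
theorem toeplitz_affineWrap_opt_eq_rotation (ψ α : ℤ → ℤ) (Ψ A : Fin (n + 1) → ℤ) (c c' M : ℤ) (hM : 0 < M)
    (hψ : ∀ a b : Fin (n + 1), M * ψ ((a : ℤ) - b) = Ψ (a - b) + c * ((a : ℤ) - b))
    (hα : ∀ a b : Fin (n + 1), M * α ((a : ℤ) - b) = A (a - b) + c' * ((a : ℤ) - b))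
    (P : ℤ → Prop) (hP : ∀ s b : Fin (n + 1), P (((Equiv.addRight s b : Fin (n + 1)) : ℤ) - b))
    (θ : ℤ) (τ : Equiv.Perm (Fin (n + 1)))
    (huniq : ∀ σ : Equiv.Perm (Fin (n + 1)), σ ≠ τ → (∀ b, P ((σ b : ℤ) - b)) →
      ∑ b, (θ * ψ ((σ b : ℤ) - b) + α ((σ b : ℤ) - b)) < ∑ b, (θ * ψ ((τ b : ℤ) - b) + α ((τ b : ℤ) - b))) :
    ∃ s : Fin (n + 1), τ = Equiv.addRight s := by
  obtain ⟨s, -, hs⟩ := exists_max_image univ (fun r : Fin (n + 1) => θ * Ψ r + A r) univ_nonempty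
  refine ⟨s, ?_⟩
  by_contra hne
  have hlt := huniq (Equiv.addRight s) (Ne.symm hne) (fun b => hP s b)
  -- `M`-fold weight of the rotation: `(n+1) · G s`
  have h1 : M * ∑ b, (θ * ψ (((Equiv.addRight s b : Fin (n + 1)) : ℤ) - b) +
      α (((Equiv.addRight s b : Fin (n + 1)) : ℤ) - b)) = ∑ _b : Fin (n + 1), (θ * Ψ s + A s) := by
    rw [mul_weight_eq_sum_residue ψ α Ψ A c c' M θ hψ hα (Equiv.addRight s)]
    exact sum_congr rfl fun b _ => by rw [addRight_sub_self]
  -- `M`-fold weight of `τ` is termwise at most `G s`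
  have h2 : M * ∑ b, (θ * ψ ((τ b : ℤ) - b) + α ((τ b : ℤ) - b)) ≤ ∑ _b : Fin (n + 1), (θ * Ψ s + A s) := by
    rw [mul_weight_eq_sum_residue ψ α Ψ A c c' M θ hψ hα τ]
    exact sum_le_sum fun b _ => hs (τ b - b) (mem_univ _)
  have h3 := mul_lt_mul_of_pos_left hlt hM
  exact absurd (h1 ▸ h3) (not_lt.mpr h2)

/-- **The «m-phase» bound of Conjecture T.**  For residue-affine `ψ`, `α` (positive multiplier `M`) with all rotations
admissible, any family `τ₀, …, τ_N` of PAIRWISE DISTINCT permutations of `Fin (n+1)`, each the unique maximiser among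
admissible permutations at its own integer slope `θ' k`, has `N + 1 ≤ n + 1` members — every member is a rotation
(`toeplitz_affineWrap_opt_eq_rotation`) and there are `n + 1` rotations.  No monotonicity of the slopes is used, so this is
(slightly more than) the hypothesis shape of `toeplitz_chain_le_of_linearBound` with `Φ = n + 1` on this class of
instances. [folklore] -/
theorem toeplitz_affineWrap_chain_succ_le (ψ α : ℤ → ℤ) (Ψ A : Fin (n + 1) → ℤ) (c c' M : ℤ) (hM : 0 < M)
    (hψ : ∀ a b : Fin (n + 1), M * ψ ((a : ℤ) - b) = Ψ (a - b) + c * ((a : ℤ) - b))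
    (hα : ∀ a b : Fin (n + 1), M * α ((a : ℤ) - b) = A (a - b) + c' * ((a : ℤ) - b))
    (P : ℤ → Prop) (hP : ∀ s b : Fin (n + 1), P (((Equiv.addRight s b : Fin (n + 1)) : ℤ) - b))
    {N : ℕ} (θ' : Fin (N + 1) → ℤ) (τ : Fin (N + 1) → Equiv.Perm (Fin (n + 1))) (hinj : Function.Injective τ)
    (huniq : ∀ k (σ : Equiv.Perm (Fin (n + 1))), σ ≠ τ k → (∀ b, P ((σ b : ℤ) - b)) →
      ∑ b, (θ' k * ψ ((σ b : ℤ) - b) + α ((σ b : ℤ) - b)) <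
        ∑ b, (θ' k * ψ ((τ k b : ℤ) - b) + α ((τ k b : ℤ) - b))) :
    N + 1 ≤ n + 1 := by
  choose s hs using fun k =>
    toeplitz_affineWrap_opt_eq_rotation ψ α Ψ A c c' M hM hψ hα P hP (θ' k) (τ k) (huniq k)
  have hsinj : Function.Injective s := fun k k' h => hinj (by rw [hs k, hs k', h])
  simpa using Fintype.card_le_of_injective s hsinj

/-- The wrap indicator is residue-affine: `(n+1)·[a < b] = (a − b mod (n+1)) − (a − b)` for `a b : Fin (n+1)`
(`val_sub_add_val_eq` in `ℤ`). [folklore] -/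
theorem wrap_eq_residue_sub (a b : Fin (n + 1)) :
    ((n + 1 : ℕ) : ℤ) * (if a < b then 1 else 0) = ((a - b : Fin (n + 1)) : ℕ) - ((a : ℤ) - b) := by
  have h := val_sub_add_val_eq a b
  have h' : (((a - b : Fin (n + 1)) : ℕ) : ℤ) + (b : ℕ) = (a : ℕ) + ((n + 1 : ℕ) : ℤ) * (if a < b then 1 else 0) := by
    split_ifs with hab
    · rw [if_pos hab] at h; exact_mod_cast h
    · rw [if_neg hab] at h; exact_mod_cast h
  push_cast at h' ⊢
  linarith

/-- **Wrap-affine form.**  If `ψ(a − b) = ψ₀(a − b mod (n+1)) + D·[a < b]` and `α(a − b) = α₀(a − b mod (n+1)) + E·[a < b]`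
on all entries (cyclic part plus a multiple of the WRAP INDICATOR, on the slopes as well as on the intercepts), every rotation
is admissible, and `τ` is the unique maximiser among admissible permutations at the slope `θ`, then `τ` is a rotation:
multiply by `n + 1` and use `wrap_eq_residue_sub` to reach the residue-affine form of
`toeplitz_affineWrap_opt_eq_rotation`. [folklore] -/
theorem toeplitz_wrapAffine_opt_eq_rotation (ψ α : ℤ → ℤ) (ψ₀ α₀ : Fin (n + 1) → ℤ) (D E : ℤ)
    (hψ : ∀ a b : Fin (n + 1), ψ ((a : ℤ) - b) = ψ₀ (a - b) + D * (if a < b then 1 else 0))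
    (hα : ∀ a b : Fin (n + 1), α ((a : ℤ) - b) = α₀ (a - b) + E * (if a < b then 1 else 0))
    (P : ℤ → Prop) (hP : ∀ s b : Fin (n + 1), P (((Equiv.addRight s b : Fin (n + 1)) : ℤ) - b))
    (θ : ℤ) (τ : Equiv.Perm (Fin (n + 1)))
    (huniq : ∀ σ : Equiv.Perm (Fin (n + 1)), σ ≠ τ → (∀ b, P ((σ b : ℤ) - b)) →
      ∑ b, (θ * ψ ((σ b : ℤ) - b) + α ((σ b : ℤ) - b)) < ∑ b, (θ * ψ ((τ b : ℤ) - b) + α ((τ b : ℤ) - b))) :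
    ∃ s : Fin (n + 1), τ = Equiv.addRight s := by
  refine toeplitz_affineWrap_opt_eq_rotation ψ α
    (fun r => ((n + 1 : ℕ) : ℤ) * ψ₀ r + D * (r : ℕ)) (fun r => ((n + 1 : ℕ) : ℤ) * α₀ r + E * (r : ℕ))
    (-D) (-E) ((n + 1 : ℕ) : ℤ) (by exact_mod_cast Nat.succ_pos n) (fun a b => ?_) (fun a b => ?_) P hP θ τ huniq
  · have hw := wrap_eq_residue_sub a b
    rw [hψ, mul_add, ← mul_assoc, mul_comm _ D, mul_assoc, hw]
    ring
  · have hw := wrap_eq_residue_sub a b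
    rw [hα, mul_add, ← mul_assoc, mul_comm _ E, mul_assoc, hw]
    ring

/-- **Wrap-affine form of the «m-phase» bound**: with `ψ`, `α` a cyclic part plus a multiple of the wrap indicator and all
rotations admissible, any family of pairwise distinct unique maximisers (each at its own slope) has at most `n + 1`
members. [folklore] -/
theorem toeplitz_wrapAffine_chain_succ_le (ψ α : ℤ → ℤ) (ψ₀ α₀ : Fin (n + 1) → ℤ) (D E : ℤ)
    (hψ : ∀ a b : Fin (n + 1), ψ ((a : ℤ) - b) = ψ₀ (a - b) + D * (if a < b then 1 else 0))
    (hα : ∀ a b : Fin (n + 1), α ((a : ℤ) - b) = α₀ (a - b) + E * (if a < b then 1 else 0))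
    (P : ℤ → Prop) (hP : ∀ s b : Fin (n + 1), P (((Equiv.addRight s b : Fin (n + 1)) : ℤ) - b))
    {N : ℕ} (θ' : Fin (N + 1) → ℤ) (τ : Fin (N + 1) → Equiv.Perm (Fin (n + 1))) (hinj : Function.Injective τ)
    (huniq : ∀ k (σ : Equiv.Perm (Fin (n + 1))), σ ≠ τ k → (∀ b, P ((σ b : ℤ) - b)) →
      ∑ b, (θ' k * ψ ((σ b : ℤ) - b) + α ((σ b : ℤ) - b)) <
        ∑ b, (θ' k * ψ ((τ k b : ℤ) - b) + α ((τ k b : ℤ) - b))) :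
    N + 1 ≤ n + 1 := by
  choose s hs using fun k =>
    toeplitz_wrapAffine_opt_eq_rotation ψ α ψ₀ α₀ D E hψ hα P hP (θ' k) (τ k) (huniq k)
  have hsinj : Function.Injective s := fun k k' h => hinj (by rw [hs k, hs k', h])
  simpa using Fintype.card_le_of_injective s hsinj

end AffineWrap

end Summit.ValiantsHypothesis.ValiantsHypothesis.Theorems.KPlusLogSqLaw
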